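import Mathlib
import Summits.AnomalousDissipation.AnomalousDissipation.Theorems.LimitingAbsorptionRelaxationBoundsInventoryShift
import Summits.AnomalousDissipation.AnomalousDissipation.Theorems.FloorUpgrade.Negative.SpeedLimitTools
import Summits.AnomalousDissipation.AnomalousDissipation.Theorems.FloorUpgrade.Negative.BallisticBound
import Literature.Analysis.FluidPDE.PassiveScalarReleaseExistence
import Literature.Analysis.FluidPDE.PassiveScalarProofs
import Literature.Analysis.FluidPDE.AgeDecouplingWindows
import Literature.Analysis.FluidPDE.CheskidovAssemblyTools
import Literature.Analysis.FluidPDE.TurbWave0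
import HarnessLib

/-!
# Negative knowledge for the crux `FloorUpgrade` (stmt-AnomalousDissipation-15010), IV:
# the transport speed limit in sharp form — relaxation is never faster than sweeping

Route `route-AnomalousDissipation-LimitingAbsorption`, crux r4 `…Theses.LimitingAbsorption.FloorUpgrade`;
supports stmt-AnomalousDissipation-15010 (refuter lane; no route statement concluded). Tightness-type lemma
for the relaxation clause `(U_h)` shared by the cruxes r2 (`UniformRelaxationWitness`), r3
(`RelaxingFamily`) and by every witness of `FloorUpgrade`:

`relaxation_speed_limit`: if global Leray–Hopf drifts `v_j` (any forces), jointly smooth and essentially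
bounded on bounded slabs, relax a smooth profile `h` from every phase with constants `(C, γ)` uniformly in
`j` (`ν_j → 0`), and the energies have an eventual Cesàro bound `timeMean (∫‖v_j‖²) T ≤ E`, then for EVERY
lag `s > 0`

  `‖h‖²₂ (1 - √C e^{-γ s/2}) ≤ 2 G² E s²`,   `G = sup ‖∇h‖`.

Equivalently, with the ballistic decorrelation rate `Λ² = 4G²E/‖h‖²`: `1 - √C e^{-γs/2} ≤ Λ² s²/2`, so
`γ ≤ Λ · inf_{x>log √C} 2x/√(2(1 - √C e^{-x})) = O(Λ log(e + C))`: the decay clock of `(U_h)` cannot run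
faster than the sweeping clock of the mean energy (the unconditional input is B1, `ballistic_bound`).
Part I's `energy_floor_of_ballistic` is the instance `x = 3 C^{1/6}` with crude bookkeeping.

Proof: as in Part I with the lag window `(s, s(1+η))`, Cauchy–Schwarz `⟨h, Θ(σ)⟩ ≤ √C e^{-γσ/2} ‖h‖²`,
B1, phase averaging with `AgeDecoupling.integral_window_le`, then `R → ∞`, `j → ∞`, `η → 0`.

## References

* R. J. DiPerna, P.-L. Lions, Invent. Math. 98 (1989), Prop. II.1 (weak scalars). [`DiPernaLions1989`]
* T. D. Drivas, T. M. Elgindi, G. Iyer, I.-J. Jeong, ARMA 243 (2022), (1.2)–(1.3). [`DEIJ2022`]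
-/

noncomputable section

open MeasureTheory Set Filter Function TopologicalSpace Topology
open scoped ENNReal NNReal InnerProductSpace

namespace Summit.AnomalousDissipation.AnomalousDissipation.Theorems.FloorUpgrade.Negative

set_option linter.dupNamespace false -- D-0017: `Summit.<S>.<S>.…` namespace by design

open Literature.Analysis Literature.Analysis.FluidPDE Literature.Analysis.FluidPDE.Torus

/-- `√(C e^{-γσ} L) ≤ √C e^{-γ s/2} √L` for `σ ≥ s`. [folklore] -/
theorem sqrt_decay_le {C γ s σ : ℝ} (L : ℝ) (hC : 0 ≤ C) (hγ : 0 ≤ γ) (hσ : s ≤ σ) :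
    Real.sqrt (C * Real.exp (-(γ * σ)) * L) ≤ Real.sqrt C * Real.exp (-(γ * s / 2)) * Real.sqrt L := by
  have e1 : Real.sqrt (Real.exp (-(γ * σ))) = Real.exp (-(γ * σ) / 2) := by
    rw [show -(γ * σ) = ((2 : ℕ) : ℝ) * (-(γ * σ) / 2) by push_cast; ring, Real.exp_nat_mul]
    rw [Real.sqrt_sq (Real.exp_pos _).le]
    ring_nf
  rw [Real.sqrt_mul (mul_nonneg hC (Real.exp_pos _).le), Real.sqrt_mul hC, e1]
  have h1 : Real.exp (-(γ * σ) / 2) ≤ Real.exp (-(γ * s / 2)) :=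
    Real.exp_le_exp.2 (by nlinarith)
  gcongr

set_option maxHeartbeats 800000 in
/-- **Transport speed limit (sharp form).** For global Leray–Hopf drifts `v_j` (forces `f_j`), jointly
smooth and essentially bounded on bounded slabs, relaxing a smooth profile `h` from every phase with
constants `(C, γ)` uniformly in `j` — the clause `(U_h)` of `RelaxingFamily` — and with an eventual Cesàro
bound `E` of `∫‖v_j‖²`: for every lag `s > 0`, `‖h‖²(1 - √C e^{-γs/2}) ≤ 2 G² E s²` where `‖∇h‖ ≤ G`
(unconditional: B1 is `ballistic_bound`). [folklore] -/
theorem relaxation_speed_limit {h : UnitAddTorus (Fin 2) → ℝ}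
    (hh : FunctionSpaces.Torus.IsSmooth h) {ν : ℕ → ℝ}
    {f : ℕ → ℝ → UnitAddTorus (Fin 2) → EuclideanSpace ℝ (Fin 2)}
    {v₀ : ℕ → UnitAddTorus (Fin 2) → EuclideanSpace ℝ (Fin 2)}
    {v : ℕ → ℝ → UnitAddTorus (Fin 2) → EuclideanSpace ℝ (Fin 2)} (hν : ∀ j, 0 < ν j)
    (hνlim : Tendsto ν atTop (𝓝 0)) (hLH : ∀ j, IsGlobalLerayHopf (ν j) (f j) (v₀ j) (v j))
    (hbd : ∀ j : ℕ, ∀ (T : ℝ), 0 < T →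
      MemLp (FunctionSpaces.Torus.stLift (v j)) ⊤ (volume.restrict (Ioo (0 : ℝ) T ×ˢ univ)))
    (hsm : ∀ j, FunctionSpaces.Torus.IsSmoothSpaceTimeOn (Ici (0 : ℝ)) (v j)) {E C γ G : ℝ}
    (hEmean : ∀ j, ∀ᶠ T in atTop, timeMean (fun t => ∫ x, ‖v j t x‖ ^ 2) T ≤ E)
    (hC0 : 0 ≤ C) (hγ : 0 < γ) (hG : ∀ x, ‖FunctionSpaces.Torus.gradient h x‖ ≤ G)
    (hU : ∀ (j : ℕ) (a : ℝ), 0 ≤ a → ∀ (T : ℝ) (θ : ℝ → UnitAddTorus (Fin 2) → ℝ),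
      IsWeakScalarTransportOn T (ν j) (fun t => v j (a + t)) h θ →
        ∀ᵐ t ∂(volume.restrict (Ioo (0 : ℝ) T)),
          scalarL2Sq (θ t) ≤ C * Real.exp (-(γ * t)) * scalarL2Sq h)
    {s : ℝ} (hs : 0 < s) :
    scalarL2Sq h * (1 - Real.sqrt C * Real.exp (-(γ * s / 2))) ≤ 2 * G ^ 2 * E * s ^ 2 := by
  -- notation and profile constants
  set L : ℝ := scalarL2Sq h with hLdef
  have hL0 : 0 ≤ L := scalarL2Sq_nonneg h
  set ρ : ℝ := Real.sqrt C * Real.exp (-(γ * s / 2)) with hρdef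
  have hρ0 : 0 ≤ ρ := by positivity
  have hG0 : 0 ≤ G := (norm_nonneg _).trans (hG 0)
  set Dh : ℝ := Real.sqrt (scalarL2Sq (FunctionSpaces.Torus.laplacian h)) with hDhdef
  have hDh0 : 0 ≤ Dh := Real.sqrt_nonneg _
  have hΔ : scalarL2Sq (FunctionSpaces.Torus.laplacian h) ≤ Dh ^ 2 := by
    rw [hDhdef, Real.sq_sqrt (scalarL2Sq_nonneg _)]
  -- energies
  set F : ℕ → ℝ → ℝ := fun j t => ∫ x, ‖v j t x‖ ^ 2 with hFdef
  have hF0 : ∀ j t, 0 ≤ F j t := fun j t => integral_nonneg fun x => sq_nonneg _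
  have hFc : ∀ j, ContinuousOn (F j) (Ici 0) := fun j =>
    (hsm j).continuousOn_integral_norm_sq (convex_Ici 0)
  have hFi : ∀ j T, IntegrableOn (F j) (Ioc 0 T) volume := fun j T =>
    (((hFc j).mono Icc_subset_Ici_self).integrableOn_compact isCompact_Icc).mono_set
      Ioc_subset_Icc_self
  have hFca : ∀ j (a : ℝ), 0 ≤ a → ∀ S', ContinuousOn (fun τ => F j (a + τ)) (Icc 0 S') := by
    intro j a ha S'
    refine (hFc j).comp (continuousOn_const.add continuousOn_id) fun τ hτ => ?_
    exact mem_Ici.2 (by linarith [hτ.1])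
  have hvL2 : ∀ j (t : ℝ), 0 ≤ t → MemLp (v j t) 2 volume := fun j t ht =>
    (hLH j (t + 1) (by linarith)).memLp t ⟨ht, by linarith⟩
  have hE0 : 0 ≤ E := by
    obtain ⟨T₀, hT₀⟩ := eventually_atTop.1 (hEmean 0)
    have hT : 0 < max T₀ 1 := lt_max_of_lt_right zero_lt_one
    have h1 := hT₀ (max T₀ 1) (le_max_left _ _)
    have h2 : 0 ≤ timeMean (fun t => ∫ x, ‖v 0 t x‖ ^ 2) (max T₀ 1) :=
      mul_nonneg (inv_nonneg.2 hT.le) (intervalIntegral.integral_nonneg hT.le fun t _ => hF0 0 t)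
    exact h2.trans h1
  /- Step A: for a window parameter `η ∈ (0,1]`, `S = s (1 + η)`, every `j` and every phase `a ≥ 0`:
     `L (1 - ρ) ≤ 2 ν_j S √L Dh + 2 G² S ∫_{(0,S)} F_j (a + τ) dτ`. -/
  have stepA : ∀ (η : ℝ), 0 < η → ∀ j (a : ℝ), 0 ≤ a →
      L * (1 - ρ) ≤ 2 * ν j * (s * (1 + η)) * Real.sqrt L * Dh +
        2 * G ^ 2 * (s * (1 + η)) * ∫ τ in Ioo 0 (s * (1 + η)), F j (a + τ) := by
    intro η hη j a ha
    set S : ℝ := s * (1 + η) with hSdef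
    have hS0 : 0 < S := by positivity
    have hsS : s < S := by rw [hSdef]; nlinarith
    set T : ℝ := 2 * S with hTdef
    have hT0 : 0 < T := by positivity
    have hST : S < T := by rw [hTdef]; linarith
    obtain ⟨Θ, hΘ, -⟩ := (hLH j).exists_release (hν j) hT0 ha (hh.memLp 2)
    have hUh := hU j a ha T Θ hΘ
    have hu' : MemLp (FunctionSpaces.Torus.stLift (fun t => v j (a + t))) ⊤
        (volume.restrict (Ioo (0 : ℝ) T ×ˢ univ)) := by
      have := Summit.AnomalousDissipation.AnomalousDissipation.Theorems.LapInventory.memLp_top_stLift_comp_const_add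
        ha (hbd j (a + T) (by linarith))
      rwa [show a + T - a = T by ring] at this
    have hB1 := ballistic_bound (ν j) T Dh (fun t => v j (a + t)) h Θ (hν j) hh hDh0 hΔ hu' hΘ
    have hL2 := hΘ.ae_memLp_two
    have hsub : Ioo s S ⊆ Ioo 0 T := Ioo_subset_Ioo hs.le hST.le
    have hall : ∀ᵐ σ ∂(volume.restrict (Ioo s S)), σ ∈ Ioo s S ∧
        (scalarL2Sq (Θ σ) ≤ C * Real.exp (-(γ * σ)) * L ∧
        (L - ∫ x, h x * Θ σ x ≤ 2 * ν j * σ * Real.sqrt L * Dh +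
          2 * (∫ τ in Ioo (0 : ℝ) σ, Real.sqrt (∫ x,
            (⟪v j (a + τ) x, FunctionSpaces.Torus.gradient h x⟫_ℝ) ^ 2)) ^ 2) ∧
        MemLp (Θ σ) 2 volume) := by
      have h3 := ae_restrict_of_ae_restrict_of_subset hsub (hUh.and (hB1.and hL2))
      filter_upwards [ae_restrict_mem measurableSet_Ioo, h3] with σ hσ h3
      exact ⟨hσ, h3⟩
    haveI : (ae ((volume : Measure ℝ).restrict (Ioo s S))).NeBot := by
      rw [ae_neBot, Ne, Measure.restrict_eq_zero, Real.volume_Ioo, ENNReal.ofReal_eq_zero, not_le]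
      linarith
    obtain ⟨σ, hσ, hdec, hbal, hmem⟩ := hall.exists
    have hσ0 : 0 < σ := hs.trans hσ.1
    -- Cauchy–Schwarz and the decay at lag `σ`: `⟨h, Θ σ⟩ ≤ ρ L`
    have hCS : ∫ x, h x * Θ σ x ≤ ρ * L := by
      have h1 : ∫ x, h x * Θ σ x ≤ Real.sqrt L * Real.sqrt (scalarL2Sq (Θ σ)) :=
        integral_mul_le_sqrt_mul_sqrt_of_memLp (hh.memLp 2) hmem
      have h2 : Real.sqrt (scalarL2Sq (Θ σ)) ≤ Real.sqrt C * Real.exp (-(γ * s / 2)) * Real.sqrt L :=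
        (Real.sqrt_le_sqrt hdec).trans (sqrt_decay_le L hC0 hγ.le hσ.1.le)
      calc ∫ x, h x * Θ σ x ≤ Real.sqrt L * Real.sqrt (scalarL2Sq (Θ σ)) := h1
        _ ≤ Real.sqrt L * (Real.sqrt C * Real.exp (-(γ * s / 2)) * Real.sqrt L) := by gcongr
        _ = ρ * L := by
            rw [hρdef, show Real.sqrt L * (Real.sqrt C * Real.exp (-(γ * s / 2)) * Real.sqrt L) =
              Real.sqrt C * Real.exp (-(γ * s / 2)) * (Real.sqrt L * Real.sqrt L) by ring,
              Real.mul_self_sqrt hL0]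
    -- the velocity term
    have hvel : (∫ τ in Ioo (0 : ℝ) σ, Real.sqrt (∫ x,
        (⟪v j (a + τ) x, FunctionSpaces.Torus.gradient h x⟫_ℝ) ^ 2)) ^ 2 ≤
        G ^ 2 * S * ∫ τ in Ioo 0 S, F j (a + τ) := by
      have hcontS : ContinuousOn (fun τ => G * Real.sqrt (F j (a + τ))) (Icc 0 S) :=
        continuousOn_const.mul (Real.continuous_sqrt.comp_continuousOn (hFca j a ha S))
      have hintS : IntegrableOn (fun τ => G * Real.sqrt (F j (a + τ))) (Ioo 0 S) volume :=
        (hcontS.integrableOn_compact isCompact_Icc).mono_set Ioo_subset_Icc_self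
      have h1 : ∫ τ in Ioo (0 : ℝ) σ, Real.sqrt (∫ x,
          (⟪v j (a + τ) x, FunctionSpaces.Torus.gradient h x⟫_ℝ) ^ 2) ≤
          ∫ τ in Ioo (0 : ℝ) σ, G * Real.sqrt (F j (a + τ)) := by
        refine integral_mono_of_nonneg (Eventually.of_forall fun τ => Real.sqrt_nonneg _)
          (hintS.mono_set (Ioo_subset_Ioo_right hσ.2.le)) ?_
        filter_upwards [ae_restrict_mem measurableSet_Ioo] with τ hτ
        exact sqrt_integral_inner_gradient_sq_le (hvL2 j (a + τ) (by linarith [hτ.1])) hG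
      have h2 : ∫ τ in Ioo (0 : ℝ) σ, G * Real.sqrt (F j (a + τ)) ≤
          ∫ τ in Ioo (0 : ℝ) S, G * Real.sqrt (F j (a + τ)) :=
        setIntegral_mono_set hintS
          (Eventually.of_forall fun τ => mul_nonneg hG0 (Real.sqrt_nonneg _))
          (Ioo_subset_Ioo_right hσ.2.le).eventuallyLE
      have h3 : (∫ τ in Ioo (0 : ℝ) S, Real.sqrt (F j (a + τ))) ^ 2 ≤
          S * ∫ τ in Ioo 0 S, F j (a + τ) :=
        sq_setIntegral_sqrt_le hS0.le (hFca j a ha S) fun τ _ => hF0 j (a + τ)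
      have h0 : 0 ≤ ∫ τ in Ioo (0 : ℝ) σ, Real.sqrt (∫ x,
          (⟪v j (a + τ) x, FunctionSpaces.Torus.gradient h x⟫_ℝ) ^ 2) :=
        integral_nonneg fun τ => Real.sqrt_nonneg _
      have h4 := h1.trans h2
      rw [integral_const_mul] at h4
      calc (∫ τ in Ioo (0 : ℝ) σ, Real.sqrt (∫ x,
            (⟪v j (a + τ) x, FunctionSpaces.Torus.gradient h x⟫_ℝ) ^ 2)) ^ 2
          ≤ (G * ∫ τ in Ioo (0 : ℝ) S, Real.sqrt (F j (a + τ))) ^ 2 := pow_le_pow_left₀ h0 h4 2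
        _ = G ^ 2 * (∫ τ in Ioo (0 : ℝ) S, Real.sqrt (F j (a + τ))) ^ 2 := by ring
        _ ≤ G ^ 2 * (S * ∫ τ in Ioo 0 S, F j (a + τ)) := by gcongr
        _ = G ^ 2 * S * ∫ τ in Ioo 0 S, F j (a + τ) := by ring
    have hdiff : 2 * ν j * σ * Real.sqrt L * Dh ≤ 2 * ν j * S * Real.sqrt L * Dh := by
      have hK0 : 0 ≤ ν j * Real.sqrt L * Dh := mul_nonneg (mul_nonneg (hν j).le (Real.sqrt_nonneg _)) hDh0
      calc 2 * ν j * σ * Real.sqrt L * Dh = (2 * σ) * (ν j * Real.sqrt L * Dh) := by ring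
        _ ≤ (2 * S) * (ν j * Real.sqrt L * Dh) :=
            mul_le_mul_of_nonneg_right (by linarith [hσ.2]) hK0
        _ = 2 * ν j * S * Real.sqrt L * Dh := by ring
    have : L * (1 - ρ) = L - ρ * L := by ring
    rw [this]
    linarith [hbal, hCS, hvel, hdiff]
  /- Step B: average Step A over the phases; with `R ≥ S/δ`:
     `L(1 - ρ) ≤ 2 ν_j S √L Dh + 2 G² S² (1 + δ) E`. -/
  have stepB : ∀ (η : ℝ), 0 < η → ∀ (δ : ℝ), 0 < δ → ∀ j,
      L * (1 - ρ) ≤ 2 * ν j * (s * (1 + η)) * Real.sqrt L * Dh +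
        2 * G ^ 2 * (s * (1 + η)) ^ 2 * (1 + δ) * E := by
    intro η hη δ hδ j
    set S : ℝ := s * (1 + η) with hSdef
    have hS0 : 0 < S := by positivity
    obtain ⟨T₀, hT₀⟩ := eventually_atTop.1 (hEmean j)
    set R : ℝ := max T₀ (S / δ) + 1 with hRdef
    have hRδ : S / δ ≤ R := by rw [hRdef]; linarith [le_max_right T₀ (S / δ)]
    have hR0 : 0 < R := by
      have : 0 < S / δ := div_pos hS0 hδ
      linarith
    have hRT : T₀ ≤ R + S := by rw [hRdef]; linarith [le_max_left T₀ (S / δ)]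
    have hSR : S ≤ δ * R := by
      have := (div_le_iff₀ hδ).1 hRδ
      linarith [mul_comm R δ]
    have hAW : ∀ t ∈ Icc S (R + S), L * (1 - ρ) ≤
        2 * ν j * S * Real.sqrt L * Dh + 2 * G ^ 2 * S * ∫ τ in (t - S)..t, F j τ := by
      intro t ht
      have hta : 0 ≤ t - S := by linarith [ht.1]
      have hA := stepA η hη j (t - S) hta
      have e : ∫ τ in Ioo 0 S, F j (t - S + τ) = ∫ τ in (t - S)..t, F j τ := by
        rw [← integral_Ioc_eq_integral_Ioo, ← intervalIntegral.integral_of_le hS0.le,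
          intervalIntegral.integral_comp_add_left (F j) (t - S), add_zero, sub_add_cancel]
      rw [e] at hA
      exact hA
    have hWint : IntervalIntegrable (fun t => ∫ τ in (t - S)..t, F j τ) volume S (R + S) :=
      AgeDecoupling.intervalIntegrable_window (hFi j) hS0.le (by linarith)
    have hmono := intervalIntegral.integral_mono_on (μ := volume) (a := S) (b := R + S)
      (f := fun _ => L * (1 - ρ))
      (g := fun t => 2 * ν j * S * Real.sqrt L * Dh + 2 * G ^ 2 * S * ∫ τ in (t - S)..t, F j τ)
      (by linarith) intervalIntegrable_const (intervalIntegrable_const.add (hWint.const_mul _)) hAW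
    have eL : ∫ _ in S..(R + S), (L * (1 - ρ) : ℝ) = R * (L * (1 - ρ)) := by
      rw [intervalIntegral.integral_const, smul_eq_mul]; ring
    have eR : ∫ t in S..(R + S),
        (2 * ν j * S * Real.sqrt L * Dh + 2 * G ^ 2 * S * ∫ τ in (t - S)..t, F j τ) =
        R * (2 * ν j * S * Real.sqrt L * Dh) +
          2 * G ^ 2 * S * ∫ t in S..(R + S), ∫ τ in (t - S)..t, F j τ := by
      rw [intervalIntegral.integral_add intervalIntegrable_const (hWint.const_mul _),
        intervalIntegral.integral_const, intervalIntegral.integral_const_mul, smul_eq_mul]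
      ring
    rw [eL, eR] at hmono
    have hwin : ∫ t in S..(R + S), (∫ τ in (t - S)..t, F j τ) ≤ S * ∫ τ in (0 : ℝ)..(R + S), F j τ :=
      AgeDecoupling.integral_window_le (hFi j) (hF0 j) hS0.le (by linarith)
    have hmean : ∫ τ in (0 : ℝ)..(R + S), F j τ ≤ (R + S) * E := by
      have h1 := hT₀ (R + S) hRT
      have hRS0 : 0 < R + S := by linarith
      unfold timeMean at h1
      rw [inv_mul_le_iff₀ hRS0] at h1
      exact h1
    have hGs : 0 ≤ 2 * G ^ 2 * S := by positivity
    have h1 : R * (L * (1 - ρ)) ≤ R * (2 * ν j * S * Real.sqrt L * Dh) +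
        2 * G ^ 2 * S * (S * ((R + S) * E)) := by
      have := mul_le_mul_of_nonneg_left (hwin.trans (mul_le_mul_of_nonneg_left hmean hS0.le)) hGs
      linarith
    have h2 : 2 * G ^ 2 * S * (S * ((R + S) * E)) ≤ R * (2 * G ^ 2 * S ^ 2 * (1 + δ) * E) := by
      have hSR' : S * (R + S) ≤ (1 + δ) * R * S := by nlinarith
      have hGE : 0 ≤ G ^ 2 * E := mul_nonneg (sq_nonneg G) hE0
      nlinarith [mul_le_mul_of_nonneg_left hSR' (mul_nonneg hGE hS0.le)]
    have h3 : R * (L * (1 - ρ)) ≤ R * (2 * ν j * S * Real.sqrt L * Dh + 2 * G ^ 2 * S ^ 2 * (1 + δ) * E) := by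
      linarith
    exact le_of_mul_le_mul_left h3 hR0
  /- Step C: `j → ∞`, then `η, δ → 0`. -/
  refine le_of_forall_pos_le_add fun ε hε => ?_
  -- choose `η = δ ≤ 1` with `14 G² E s² η ≤ ε/2`, then `j` with `2 ν_j (2s) √L Dh ≤ ε/2`
  set η : ℝ := min 1 (ε / (28 * (G ^ 2 * E * s ^ 2) + 2)) with hηdef
  have hden : 0 < 28 * (G ^ 2 * E * s ^ 2) + 2 := by positivity
  have hη0 : 0 < η := lt_min zero_lt_one (div_pos hε hden)
  have hη1 : η ≤ 1 := min_le_left _ _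
  have hηε : 14 * (G ^ 2 * E * s ^ 2) * η ≤ ε / 2 := by
    have h1 : η ≤ ε / (28 * (G ^ 2 * E * s ^ 2) + 2) := min_le_right _ _
    have h2 : 14 * (G ^ 2 * E * s ^ 2) * (ε / (28 * (G ^ 2 * E * s ^ 2) + 2)) ≤ ε / 2 := by
      rw [mul_div_assoc', div_le_div_iff₀ hden two_pos]
      nlinarith [mul_nonneg (mul_nonneg (sq_nonneg G) hE0) (sq_nonneg s)]
    have h0 : 0 ≤ 14 * (G ^ 2 * E * s ^ 2) := by positivity
    exact (mul_le_mul_of_nonneg_left h1 h0).trans h2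
  have hK0 : 0 < 4 * s * Real.sqrt L * Dh + 1 := by positivity
  have hb : 0 < ε / 2 / (4 * s * Real.sqrt L * Dh + 1) := by positivity
  obtain ⟨j, hj⟩ := (hνlim.eventually (Iio_mem_nhds hb)).exists
  have hj' : ν j * (4 * s * Real.sqrt L * Dh + 1) < ε / 2 := by
    have := (lt_div_iff₀ hK0).1 (show ν j < ε / 2 / (4 * s * Real.sqrt L * Dh + 1) from hj)
    linarith
  have hB := stepB η hη0 η hη0 j
  have hν0 : 0 < ν j := hν j
  -- `2 ν_j s(1+η) √L Dh ≤ ν_j (4 s √L Dh)` and `(1+η)²(1+η) ≤ 1 + 7η`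
  have h1 : 2 * ν j * (s * (1 + η)) * Real.sqrt L * Dh ≤ ν j * (4 * s * Real.sqrt L * Dh + 1) - ν j := by
    have hK : 0 ≤ s * Real.sqrt L * Dh := by positivity
    nlinarith [mul_nonneg hν0.le hK]
  have h2 : 2 * G ^ 2 * (s * (1 + η)) ^ 2 * (1 + η) * E ≤ 2 * G ^ 2 * E * s ^ 2 + 14 * (G ^ 2 * E * s ^ 2) * η := by
    have hcube : (1 + η) ^ 2 * (1 + η) ≤ 1 + 7 * η := by nlinarith [sq_nonneg η, mul_nonneg hη0.le (sq_nonneg η)]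
    have hGEs : 0 ≤ G ^ 2 * E * s ^ 2 := by positivity
    nlinarith [mul_le_mul_of_nonneg_left hcube hGEs]
  linarith

end Summit.AnomalousDissipation.AnomalousDissipation.Theorems.FloorUpgrade.Negative

end
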